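import Mathlib
import Summits.Ventures.PercRepro2.Defs
import Summits.Ventures.PercRepro2.Graph
import Summits.Ventures.PercRepro2.Events
import Summits.Ventures.PercRepro2.RowC1PendZ
import Summits.Ventures.PercRepro2.RowC1PendZCells
import Summits.Ventures.PercRepro2.RowC1PendZCert
import Summits.Ventures.PercRepro2.RowC1PendZInst4
import Summits.Ventures.PercRepro2.RowC1PendZInst9
import Summits.Ventures.PercRepro2.RowC1PendZInst10
import Summits.Ventures.PercRepro2.RowC1PendZInst11
import Summits.Ventures.PercRepro2.RowC1PendZInst12
import Summits.Ventures.PercRepro2.RowC1PendZInst13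
import Summits.Ventures.PercRepro2.RowC1PendZInst14
import Summits.Ventures.PercRepro2.RowC1PendZInst15
import Summits.Ventures.PercRepro2.RowC1PendZInst16
import Summits.Ventures.PercRepro2.RowC1PendZInst17
import Summits.Ventures.PercRepro2.RowC1PendZInst18

/-!
# `zpp ≥ 0`: the pendant-root candidate (Z″) of row 2′C1 (blind cell PercRepro2, p2 g36)

For every product measure on a finite graph and vertices `v, a₂, o, b`,

  `0 ≤ zpp p ends v a₂ o b`
  `= P(Fᶜ)²·(P(O∩B) − P(O)P(B)) + (P(O∩F) − P(O)P(F))·(P(B∩F) − P(B)P(F)) − P(Fᶜ ∩ {v ↔ o})·(P(B∩F) − P(B)P(F))`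

with `F = {a₂ ↔ v}`, `O = {a₂ ↔ o}`, `B = {a₂ ↔ b}` (RowC1PendZ.lean).  The proof is the exact degree-4 certificate
of proofs/P2-G36-CERT-ZPP.md: `zpp_nonneg_of_bhk` (RowC1PendZCert.lean — the cell bridge and the algebraic identity
`zpp_cert_alg`, with the four Harris instances, the two van den Berg–Kahn instances and the mixed Harris instance
discharged inline) applied to the eleven BHK instances `inst4_cells … inst18_cells` (eight `bhk_pair`, two
`bhk_cross_cluster_avoid`, one `bhk_induced`), each written on the fifteen transitive pattern cells of the four
points.  Std axioms.
-/

namespace Summit.Ventures.PercRepro2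

namespace RowC1

section Nonneg

variable {V : Type*} {E : Type*} [Fintype E] [DecidableEq E] [Fintype V] [DecidableEq V]
  {R : Type*} [Field R] [LinearOrder R] [IsStrictOrderedRing R]

/-- **(Z″) ≥ 0**: the pendant-root candidate of row 2′C1 is nonnegative for every product measure. -/
theorem zpp_nonneg (p : E → R) (hp : IsProbVec p) (ends : E → Sym2 V) (v a₂ o b : V) :
    0 ≤ zpp p ends v a₂ o b := by
  have i4 := inst4_cells p hp ends v a₂ o b
  have i9 := inst9_cells p hp ends v a₂ o b
  have i10 := inst10_cells p hp ends v a₂ o b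
  have i11 := inst11_cells p hp ends v a₂ o b
  have i12 := inst12_cells p hp ends v a₂ o b
  have i13 := inst13_cells p hp ends v a₂ o b
  have i14 := inst14_cells p hp ends v a₂ o b
  have i15 := inst15_cells p hp ends v a₂ o b
  have i16 := inst16_cells p hp ends v a₂ o b
  have i17 := inst17_cells p hp ends v a₂ o b
  have i18 := inst18_cells p hp ends v a₂ o b
  exact zpp_nonneg_of_bhk p hp ends v a₂ o b i4 i9 i10 i11 i12 (by linarith [i13]) i14 i15 i16 i17 i18

end Nonneg

end RowC1

end Summit.Ventures.PercRepro2
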